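import Summits.QuantumFields.BalabanUV.Beta.EriceFlowEnclosureB12AsPrintedHistoryContagionShiftFlowZero

/-!
# Beta / EriceFlowEnclosureB12AsPrintedHistoryContagionShiftFlowZeroFunctional — ASYMPTOTIC FREEDOM IS CONTAGIOUS, part 43: THE VALUE AT THE ZERO HISTORY AS A FUNCTIONAL OF
# THE THEORY.  Part 32 attached to every fading-memory functional `B` ONE number β₀(B), its value at the zero history, which parts 33–42 showed to be the one-loop coefficient
# of every asymptotically free trajectory (clock `m·g_m² → 1∕β₀`, Abel constant, two-loop law).  Here: the assignment `B ↦ β₀(B)` is (§66) **MONOTONE** (`B ≤ B′` on the box ⟹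
# `β₀(B) ≤ β₀(B′)`, `valueAtZero_mono`), **1-LIPSCHITZ IN THE SUP NORM** (`|B − B′| ≤ η` on the box ⟹ `|β₀(B) − β₀(B′)| ≤ η`, `abs_valueAtZero_sub_le` — so on part 27's open
# ball of nearby limit functionals the clock period `1∕β₀` and the Abel constant vary CONTINUOUSLY with the theory), **AFFINE** (`valueAtZero_add`, `valueAtZero_smul`), and
# (§67) computed on node U2's probes BY NAME: the exponential average `Probes.expAvg a θ` has β₀ = 0 (it VANISHES at the zero history although it depends on every coupling), the
# affine probe `Probes.affineAvg b a θ` has β₀ = b — its floor IS its one-loop coefficient —, and a MARKOV functional `u ↦ φ(u 0)` with `|φ(x) − φ₀| ≤ L·x` near 0 has β₀ = φ₀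
# (`valueAtZero_markov`): for memoryless functionals the value at the zero history is the ordinary right limit at zero coupling.  (All from part 32's modulus by testing on
# constant histories; no flow is involved.)
# Abstract in B (β-flow team, prover 1, unit `b2b-balaban-beta-bflow-p1`, gen 39; ROW AP-I·Uc × NODE U2 — the value at zero as a functional)

HONEST FRAMING (page 1 of everything the β sub-cell writes): discharging `BetaPertH` makes Bałaban's UV stability UNCONDITIONAL — a
real constructive-QFT result; it is NOT the continuum limit and NOT the Clay problem.  HONEST DEPENDENCY (cell reorg 2026-08-19,
verbatim): «continuum YM on T⁴ ⇐ BetaPertH ∧ nine spine estimates (0/9 proved); BetaPertH ⇐ (D1) ∧ (D4) ∧ CAP+tail; G-an2-4 gates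
asym, D1 and NE2/3/4.»  THIS MODULE DISCHARGES NOTHING: elementary real analysis (limits along the constant histories γ∕2ⁿ) over node U2's HYPOTHESIS SHAPES
`T4BetaStationary.{SeqBox, MemoryProfile}` and node U2's probes `T4BetaStationary.Probes.expAvg`, `T4BetaFlowWellPosed.Probes.affineAvg` BY NAME (nothing restated); the
value-at-zero LETTER of part 32 is a displayed binder.  NOTHING is asserted about Bałaban's β.  [I] = T. Bałaban, Commun. Math. Phys. **109** (1987) 249–301 [Balaban1987RG1].

WHAT THIS FILE PROVES (0 sorry, 0 def): §66 `le_of_forall_const` (the testing lemma), `abs_const_sub_valueAtZero_le`, **`valueAtZero_mono`**, **`abs_valueAtZero_sub_le`**,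
`valueAtZero_add`, `valueAtZero_smul`; §67 **`valueAtZero_expAvg`** (β₀ = 0), **`valueAtZero_affineAvg`** (β₀ = b), **`valueAtZero_markov`** (β₀ = φ₀), `valueAtZero_eq_of_letters`
(two letters at one rate name the same number).  NOT CLAIMED: anything about Bałaban's β; `BetaPertH`;
continuum; Clay.
-/

namespace Summit.QuantumFields.BalabanUV.Beta.EriceFlowEnclosureB12AsPrintedHistoryContagionShiftFlowZeroFunctional

open Finset Filter Topology
open Literature.MathematicalPhysics.QuantumFieldTheory.Balaban1983to89
open Literature.MathematicalPhysics.QuantumFieldTheory.Balaban1983to89.T4BetaStationary (SeqBox MemoryProfile)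
open Literature.MathematicalPhysics.QuantumFieldTheory.Balaban1983to89.T4BetaStationary.Probes (expAvg summable_weighted)
open Literature.MathematicalPhysics.QuantumFieldTheory.Balaban1983to89.T4BetaFlowWellPosed.Probes (affineAvg)
open Summit.QuantumFields.BalabanUV.Beta.EriceFlowEnclosureB12AsPrintedHistoryContagionShiftFlowZero (tsum_weighted_le valueAtZero_unique)

noncomputable section

/-! ## §66 Monotone, Lipschitz, affine -/

/-- **THE TESTING LEMMA.**  If a quantity X satisfies `X ≤ A + K·c` for every constant-history size `c ∈ ]0, γ]` (K fixed), then `X ≤ A` (let c → 0⁺ along γ∕2ⁿ).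
[folklore] -/
theorem le_of_forall_const {X A K γ : ℝ} (hγ : 0 < γ) (h : ∀ c : ℝ, 0 < c → c ≤ γ → X ≤ A + K * c) : X ≤ A := by
  set c : ℕ → ℝ := fun n => γ * (1 / 2) ^ n with hc
  have hc0 : ∀ n, 0 < c n := fun n => by positivity
  have hcγ : ∀ n, c n ≤ γ := fun n => by
    have : ((1 : ℝ) / 2) ^ n ≤ 1 := pow_le_one₀ (by norm_num) (by norm_num)
    simpa [hc] using mul_le_of_le_one_right hγ.le this
  have hc_lim : Tendsto c atTop (𝓝 0) := by
    have := (tendsto_pow_atTop_nhds_zero_of_lt_one (by norm_num : (0 : ℝ) ≤ 1 / 2) (by norm_num)).const_mul γ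
    simpa [hc] using this
  have herr : Tendsto (fun n => A + K * c n) atTop (𝓝 (A + K * 0)) := (hc_lim.const_mul K).const_add A
  rw [mul_zero, add_zero] at herr
  exact le_of_tendsto_of_tendsto' tendsto_const_nhds herr fun n => h (c n) (hc0 n) (hcγ n)

/-- The modulus on a constant history: `|B(c, c, …) − β₀| ≤ C_m·c∕(1 − θ)`. [folklore] -/
theorem abs_const_sub_valueAtZero_le {B : (ℕ → ℝ) → ℝ} {Cm θ γ β₀ c : ℝ} (hCm : 0 ≤ Cm) (hθ0 : 0 ≤ θ) (hθ1 : θ < 1)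
    (h0 : ∀ u : ℕ → ℝ, SeqBox γ u → |B u - β₀| ≤ Cm * ∑' j, θ ^ j * u j) (hc : 0 < c) (hcγ : c ≤ γ) :
    |B (fun _ => c) - β₀| ≤ Cm / (1 - θ) * c := by
  have hbox : SeqBox γ (fun _ : ℕ => c) := fun _ => ⟨hc, hcγ⟩
  have hboxc : SeqBox c (fun _ : ℕ => c) := fun _ => ⟨hc, le_rfl⟩
  calc |B (fun _ => c) - β₀| ≤ Cm * ∑' j, θ ^ j * (fun _ : ℕ => c) j := h0 _ hbox
    _ ≤ Cm * (c / (1 - θ)) := mul_le_mul_of_nonneg_left (tsum_weighted_le hθ0 hθ1 hboxc) hCm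
    _ = Cm / (1 - θ) * c := by ring

/-- **THE VALUE AT THE ZERO HISTORY IS MONOTONE IN THE FUNCTIONAL**: if `B u ≤ B′ u` for every box history and β₀, β₀′ are the values of B, B′ at the zero history (moduli with
constants `(C_m, θ)`, `(C_m′, θ′)`), then `β₀ ≤ β₀′`. [folklore] -/
theorem valueAtZero_mono {B B' : (ℕ → ℝ) → ℝ} {Cm Cm' θ θ' γ β₀ β₀' : ℝ} (hCm : 0 ≤ Cm) (hθ0 : 0 ≤ θ) (hθ1 : θ < 1)
    (hCm' : 0 ≤ Cm') (hθ0' : 0 ≤ θ') (hθ1' : θ' < 1) (hγ : 0 < γ)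
    (h0 : ∀ u : ℕ → ℝ, SeqBox γ u → |B u - β₀| ≤ Cm * ∑' j, θ ^ j * u j)
    (h0' : ∀ u : ℕ → ℝ, SeqBox γ u → |B' u - β₀'| ≤ Cm' * ∑' j, θ' ^ j * u j)
    (hle : ∀ u : ℕ → ℝ, SeqBox γ u → B u ≤ B' u) : β₀ ≤ β₀' := by
  have h := le_of_forall_const (X := β₀) (A := β₀') (K := Cm / (1 - θ) + Cm' / (1 - θ')) hγ fun c hc hcγ => by
    have h1 := abs_const_sub_valueAtZero_le hCm hθ0 hθ1 h0 hc hcγ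
    have h2 := abs_const_sub_valueAtZero_le hCm' hθ0' hθ1' h0' hc hcγ
    have h3 := hle (fun _ => c) (fun _ => ⟨hc, hcγ⟩)
    rw [abs_le] at h1 h2
    nlinarith [h1.1, h1.2, h2.1, h2.2]
  exact h

/-- **THE VALUE AT THE ZERO HISTORY IS 1-LIPSCHITZ IN THE SUP NORM**: if `|B u − B′ u| ≤ η` for every box history, then `|β₀ − β₀′| ≤ η` — on part 27's open ball of nearby
functionals the one-loop coefficient, the clock period 1∕β₀ and the Abel constant vary continuously. [folklore] -/
theorem abs_valueAtZero_sub_le {B B' : (ℕ → ℝ) → ℝ} {Cm Cm' θ θ' γ β₀ β₀' η : ℝ} (hCm : 0 ≤ Cm) (hθ0 : 0 ≤ θ) (hθ1 : θ < 1)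
    (hCm' : 0 ≤ Cm') (hθ0' : 0 ≤ θ') (hθ1' : θ' < 1) (hγ : 0 < γ)
    (h0 : ∀ u : ℕ → ℝ, SeqBox γ u → |B u - β₀| ≤ Cm * ∑' j, θ ^ j * u j)
    (h0' : ∀ u : ℕ → ℝ, SeqBox γ u → |B' u - β₀'| ≤ Cm' * ∑' j, θ' ^ j * u j)
    (hclose : ∀ u : ℕ → ℝ, SeqBox γ u → |B u - B' u| ≤ η) : |β₀ - β₀'| ≤ η := by
  have h := le_of_forall_const (X := |β₀ - β₀'|) (A := η) (K := Cm / (1 - θ) + Cm' / (1 - θ')) hγ fun c hc hcγ => by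
    have h1 := abs_const_sub_valueAtZero_le hCm hθ0 hθ1 h0 hc hcγ
    have h2 := abs_const_sub_valueAtZero_le hCm' hθ0' hθ1' h0' hc hcγ
    have h3 := hclose (fun _ => c) (fun _ => ⟨hc, hcγ⟩)
    rw [abs_le] at h1 h2 h3 ⊢
    constructor <;> nlinarith [h1.1, h1.2, h2.1, h2.2, h3.1, h3.2]
  exact h

/-- The value at zero is ADDITIVE: `β₀(B + B′) = β₀(B) + β₀(B′)` (the sum satisfies the modulus with constant `C_m + C_m′` at a common rate θ). [folklore] -/
theorem valueAtZero_add {B B' : (ℕ → ℝ) → ℝ} {Cm Cm' θ γ β₀ β₀' : ℝ}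
    (h0 : ∀ u : ℕ → ℝ, SeqBox γ u → |B u - β₀| ≤ Cm * ∑' j, θ ^ j * u j)
    (h0' : ∀ u : ℕ → ℝ, SeqBox γ u → |B' u - β₀'| ≤ Cm' * ∑' j, θ ^ j * u j) :
    ∀ u : ℕ → ℝ, SeqBox γ u → |(B u + B' u) - (β₀ + β₀')| ≤ (Cm + Cm') * ∑' j, θ ^ j * u j := by
  intro u hu
  have h1 := h0 u hu
  have h2 := h0' u hu
  calc |(B u + B' u) - (β₀ + β₀')| = |(B u - β₀) + (B' u - β₀')| := by ring_nf
    _ ≤ |B u - β₀| + |B' u - β₀'| := abs_add_le _ _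
    _ ≤ _ := by linarith

/-- The value at zero is HOMOGENEOUS: `β₀(a·B) = a·β₀(B)` (modulus constant `|a|·C_m`). [folklore] -/
theorem valueAtZero_smul {B : (ℕ → ℝ) → ℝ} {Cm θ γ β₀ a : ℝ}
    (h0 : ∀ u : ℕ → ℝ, SeqBox γ u → |B u - β₀| ≤ Cm * ∑' j, θ ^ j * u j) :
    ∀ u : ℕ → ℝ, SeqBox γ u → |a * B u - a * β₀| ≤ |a| * Cm * ∑' j, θ ^ j * u j := by
  intro u hu
  rw [← mul_sub, abs_mul, mul_assoc]
  exact mul_le_mul_of_nonneg_left (h0 u hu) (abs_nonneg a)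

/-! ## §67 Node U2's probes -/

/-- **THE EXPONENTIAL AVERAGE VANISHES AT THE ZERO HISTORY**: node U2's `expAvg a θ u = a·Σ θ^j u_j` (memory of EVERY coupling) has β₀ = 0, modulus `(|a|, θ)`. [folklore] -/
theorem valueAtZero_expAvg {a θ γ : ℝ} (hθ0 : 0 ≤ θ) :
    ∀ u : ℕ → ℝ, SeqBox γ u → |expAvg a θ u - 0| ≤ |a| * ∑' j, θ ^ j * u j := by
  intro u hu
  rw [sub_zero]
  unfold expAvg
  rw [abs_mul, abs_of_nonneg (tsum_nonneg fun j => mul_nonneg (pow_nonneg hθ0 j) (hu j).1.le)]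

/-- **THE AFFINE PROBE's VALUE AT ZERO IS ITS FLOOR**: node U2's `affineAvg b a θ u = b + a·Σ θ^j u_j` has β₀ = b (modulus `(|a|, θ)`) — for this family the floor b of
`T4BetaFlowWellPosed.Probes.le_affineAvg` IS the one-loop coefficient of parts 32–42 (so its flows have the clock `m·g_m² → 1∕b`). [folklore] -/
theorem valueAtZero_affineAvg {b a θ γ : ℝ} (hθ0 : 0 ≤ θ) :
    ∀ u : ℕ → ℝ, SeqBox γ u → |affineAvg b a θ u - b| ≤ |a| * ∑' j, θ ^ j * u j := by
  intro u hu
  have h := valueAtZero_expAvg (a := a) hθ0 u hu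
  rw [sub_zero] at h
  unfold affineAvg
  rw [show b + expAvg a θ u - b = expAvg a θ u by ring]
  exact h

/-- **FOR A MARKOV FUNCTIONAL THE VALUE AT THE ZERO HISTORY IS THE RIGHT LIMIT AT ZERO COUPLING**: if `|φ(x) − φ₀| ≤ L·x` on ]0, γ] (L ≥ 0), then `u ↦ φ(u 0)` has β₀ = φ₀
with the modulus `(L, θ)` for every `0 ≤ θ < 1` (the age-0 term dominates). [folklore] -/
theorem valueAtZero_markov {φ : ℝ → ℝ} {φ₀ L θ γ : ℝ} (hL : 0 ≤ L) (hθ0 : 0 ≤ θ) (hθ1 : θ < 1)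
    (hφ : ∀ x : ℝ, 0 < x → x ≤ γ → |φ x - φ₀| ≤ L * x) :
    ∀ u : ℕ → ℝ, SeqBox γ u → |φ (u 0) - φ₀| ≤ L * ∑' j, θ ^ j * u j := by
  intro u hu
  have hs := summable_weighted hθ0 hθ1 hu
  have h0 : θ ^ 0 * u 0 ≤ ∑' j, θ ^ j * u j := hs.le_tsum 0 (fun j _ => mul_nonneg (pow_nonneg hθ0 j) (hu j).1.le)
  rw [pow_zero, one_mul] at h0
  exact (hφ (u 0) (hu 0).1 (hu 0).2).trans (mul_le_mul_of_nonneg_left h0 hL)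

/-- Consistency check with part 32's uniqueness: two letters for the same functional at a common rate name the same number (e.g. `affineAvg`'s b is THE β₀ of part 32).
[folklore] -/
theorem valueAtZero_eq_of_letters {B : (ℕ → ℝ) → ℝ} {Cm Cm' θ γ β₀ β₀' : ℝ} (hθ0 : 0 ≤ θ) (hθ1 : θ < 1) (hγ : 0 < γ)
    (h0 : ∀ u : ℕ → ℝ, SeqBox γ u → |B u - β₀| ≤ Cm * ∑' j, θ ^ j * u j)
    (h0' : ∀ u : ℕ → ℝ, SeqBox γ u → |B u - β₀'| ≤ Cm' * ∑' j, θ ^ j * u j) : β₀ = β₀' := by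
  have hw : ∀ u : ℕ → ℝ, SeqBox γ u → 0 ≤ ∑' j, θ ^ j * u j := fun u hu => tsum_nonneg fun j => mul_nonneg (pow_nonneg hθ0 j) (hu j).1.le
  refine valueAtZero_unique (Cm := max Cm Cm') hθ0 hθ1 hγ (fun u hu => (h0 u hu).trans ?_) (fun u hu => (h0' u hu).trans ?_)
  · exact mul_le_mul_of_nonneg_right (le_max_left _ _) (hw u hu)
  · exact mul_le_mul_of_nonneg_right (le_max_right _ _) (hw u hu)

end

end Summit.QuantumFields.BalabanUV.Beta.EriceFlowEnclosureB12AsPrintedHistoryContagionShiftFlowZeroFunctional
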